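import Literature.NumberTheory.EllipticCurves.PAdicTwoVariableTransformCharacter
import Literature.NumberTheory.EllipticCurves.PAdicDistributionSuccRestrict
import HarnessLib

/-!
# Bounded distributions with a DENSITY: `f · μ` for a uniformly continuous `f` with `‖f‖ ≤ 1`, and
# the measure `μ_β = κ⁻¹ · (κμ_β)` on `ℤ_p^×` (de Shalit 1987, I.3.3–3.5: the measure of `D log̃ g_β`
# is `κ · μ_β`)

De Shalit 1987, I.3.5 (p. 18): "in terms of `S`, `D = (1+S) d/dS` […] The moments of `μ_β` are given by
(11) `∫_G κ(σ)^k dμ_β(σ) = D^k log g̃_β(0)`"; II.4.6 (14): `log̃ g_β ∘ θ(S) = ∫_G (1+S)^{κ(σ)} dμ_β(σ)`.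
Applying `D` once: `(D log̃ g_β) ∘ θ (S) = ∫ κ(σ)(1+S)^{κ(σ)} dμ_β(σ)` — the INTEGRAL power series
`h_β := D log̃ g_β = δg_β − (π/p)·(δg_β) ∘ f` (`δ = ` Coleman's logarithmic derivative, no `p`-adic
logarithm needed) is the transform of the measure `κ · μ_β`, not of `μ_β`. The units lane of the tree
delivers `h_β`; the Galois-side construction (`restrictUnits`, `GroupDistribution.comap`, `induce`,
division) wants `μ_β` on `ℤ_p^×`. This file supplies the adapter: the distribution with a density.

* §1 `ProfiniteTower.IsUniform` (the level projections are uniformly locally constant — true for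
  `ℤ_p`, `padicInt_isUniform`, and preserved by `succ`), uniform continuity of cell-wise constant
  functions and of bounded products;
* §2 **`BoundedDistribution.density D f`** = `f · D` (`(f·D)(a) = ∫ 𝟙_a f dD`; a bounded distribution with
  the same bound when `‖f‖ ≤ 1`), `riemannSum_density`, **`integral_density`**: `∫ g d(f·D) = ∫ g f dD`;
* §3 on `ℤ_p`: `unitInv` (`x ↦ x⁻¹` on `ℤ_p^×`, `0` on `pℤ_p`; uniformly continuous of norm `≤ 1`),
  `isUnit_toZModPow_one_iff`, and **`integral_restrictUnits_density_unitInv_pow_succ`**: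
  `∫_{ℤ_p^×} x^{k+1} d(x⁻¹·ν) = ∫_{ℤ_p^×} x^k dν` — with `ν = ` the measure of `h_β` (`= κμ_β`) this reads
  `∫_{ℤ_p^×} κ^{k+1} dμ_β = ∫_{ℤ_p^×} κ^k d(κμ_β) = [S^0] D^k h_β = D^{k+1} log̃ g_β (0)`, de Shalit's (11).

Everything is a definition with a body or a theorem; no named facts, no instances, no `sorry`.

## References

* [deShalit1987] E. de Shalit, *Iwasawa theory of elliptic curves with complex multiplication* (1987),
  I.3.3–3.5 (p. 17–18), II.4.6 (14), II.4.7 (15)–(17) (p. 59–60).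
* [MazurTateTeitelbaum1986Invent] B. Mazur, J. Tate, J. Teitelbaum, Invent. Math. 84 (1986), §I.11.
-/

noncomputable section

open Filter Topology
open scoped Classical

namespace Literature.NumberTheory.EllipticCurves

/-! ### §1. Uniform towers; uniform continuity of cell-wise constant functions and of products -/

namespace ProfiniteTower

variable {X : Type*} [PseudoMetricSpace X] {T : ProfiniteTower X}

/-- **A uniform tower**: each level projection is uniformly locally constant (close points lie in one
cell). [cite: MazurTateTeitelbaum1986Invent, §I.11] -/
def IsUniform (T : ProfiniteTower X) : Prop :=
  ∀ n : ℕ, ∃ δ : ℝ, 0 < δ ∧ ∀ x y : X, dist x y < δ → T.proj n x = T.proj n y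

/-- The shifted tower of a uniform tower is uniform. [cite: MazurTateTeitelbaum1986Invent, §I.11] -/
theorem IsUniform.succ (hT : T.IsUniform) : T.succ.IsUniform := fun n ↦ hT (n + 1)

/-- On a uniform tower a function constant on the level-`n` cells is uniformly continuous.
[cite: MazurTateTeitelbaum1986Invent, §I.11] -/
theorem IsUniform.uniformContinuous_of_proj_eq (hT : T.IsUniform) (n : ℕ) {E : Type*}
    [PseudoMetricSpace E] {F : X → E} (hF : ∀ x y, T.proj n x = T.proj n y → F x = F y) :
    UniformContinuous F := by
  refine Metric.uniformContinuous_iff.mpr fun ε hε ↦ ?_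
  obtain ⟨δ, hδ, h⟩ := hT n
  refine ⟨δ, hδ, fun {x y} hxy ↦ ?_⟩
  rw [hF x y (h x y hxy), dist_self]
  exact hε

variable (p : ℕ) [Fact p.Prime] in
/-- **`ℤ_p` is a uniform tower**: `‖x − y‖ < p^{-n}` forces `x ≡ y mod p^n`.
[cite: MazurTateTeitelbaum1986Invent, §I.11] -/
theorem padicInt_isUniform : (padicInt p).IsUniform := by
  intro n
  have hp0 : (0 : ℝ) < p := by exact_mod_cast (Fact.out : p.Prime).pos
  refine ⟨(p : ℝ) ^ (-(n : ℤ)), zpow_pos hp0 _, fun x y hxy ↦ ?_⟩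
  have h : x - y ∈ RingHom.ker (PadicInt.toZModPow n : ℤ_[p] →+* ZMod (p ^ n)) := by
    rw [PadicInt.ker_toZModPow, ← PadicInt.norm_le_pow_iff_mem_span_pow, ← dist_eq_norm]
    exact hxy.le
  rw [RingHom.mem_ker, map_sub, sub_eq_zero] at h
  exact h

end ProfiniteTower

/-- **A product of bounded uniformly continuous functions is uniformly continuous** (values in a
normed field; the integrands `𝟙_a · f`, `g · f` below). [cite: MazurTateTeitelbaum1986Invent, §I.11] -/
theorem uniformContinuous_mul_of_norm_le {Y : Type*} [PseudoMetricSpace Y] {E : Type*} [NormedField E]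
    {f g : Y → E} (hf : UniformContinuous f) (hg : UniformContinuous g) {A B : ℝ}
    (hA : ∀ x, ‖f x‖ ≤ A) (hB : ∀ x, ‖g x‖ ≤ B) : UniformContinuous (fun x ↦ f x * g x) := by
  refine Metric.uniformContinuous_iff.mpr fun ε hε ↦ ?_
  have hA'0 : 0 < max A 1 := lt_of_lt_of_le one_pos (le_max_right A 1)
  have hB'0 : 0 < max B 1 := lt_of_lt_of_le one_pos (le_max_right B 1)
  obtain ⟨δ₁, hδ₁, h₁⟩ := Metric.uniformContinuous_iff.mp hf (ε / (2 * max B 1)) (div_pos hε (mul_pos two_pos hB'0))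
  obtain ⟨δ₂, hδ₂, h₂⟩ := Metric.uniformContinuous_iff.mp hg (ε / (2 * max A 1)) (div_pos hε (mul_pos two_pos hA'0))
  refine ⟨min δ₁ δ₂, lt_min hδ₁ hδ₂, fun {x y} hxy ↦ ?_⟩
  have hfx : ‖f x‖ ≤ max A 1 := (hA x).trans (le_max_left A 1)
  have hgy : ‖g y‖ ≤ max B 1 := (hB y).trans (le_max_left B 1)
  have e1 : ‖f x - f y‖ < ε / (2 * max B 1) := by
    rw [← dist_eq_norm]; exact h₁ (lt_of_lt_of_le hxy (min_le_left _ _))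
  have e2 : ‖g x - g y‖ < ε / (2 * max A 1) := by
    rw [← dist_eq_norm]; exact h₂ (lt_of_lt_of_le hxy (min_le_right _ _))
  rw [dist_eq_norm]
  have hsplit : f x * g x - f y * g y = f x * (g x - g y) + (f x - f y) * g y := by ring
  calc ‖f x * g x - f y * g y‖ = ‖f x * (g x - g y) + (f x - f y) * g y‖ := by rw [hsplit]
    _ ≤ ‖f x * (g x - g y)‖ + ‖(f x - f y) * g y‖ := norm_add_le _ _
    _ = ‖f x‖ * ‖g x - g y‖ + ‖f x - f y‖ * ‖g y‖ := by rw [norm_mul, norm_mul]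
    _ ≤ max A 1 * ‖g x - g y‖ + ‖f x - f y‖ * max B 1 :=
        add_le_add (mul_le_mul_of_nonneg_right hfx (norm_nonneg _))
          (mul_le_mul_of_nonneg_left hgy (norm_nonneg _))
    _ < max A 1 * (ε / (2 * max A 1)) + ε / (2 * max B 1) * max B 1 :=
        add_lt_add (mul_lt_mul_of_pos_left e2 hA'0) (mul_lt_mul_of_pos_right e1 hB'0)
    _ = ε := by field_simp; ring

/-! ### §2. The distribution with a density -/

namespace BoundedDistribution

variable {X : Type*} [PseudoMetricSpace X] {T : ProfiniteTower X}
variable {𝕜 : Type*} [NormedField 𝕜] [IsUltrametricDist 𝕜] [CompleteSpace 𝕜]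
variable (D : BoundedDistribution T 𝕜)

/-- `𝟙_a · f` for a level-`n` cell `a`. [cite: MazurTateTeitelbaum1986Invent, §I.11] -/
def cellFun (n : ℕ) (a : T.Cell n) (f : X → 𝕜) : X → 𝕜 :=
  fun x ↦ (if T.proj n x = a then (1 : 𝕜) else 0) * f x

omit [IsUltrametricDist 𝕜] [CompleteSpace 𝕜] in
/-- Unfolding `cellFun`. [cite: MazurTateTeitelbaum1986Invent, §I.11] -/
theorem cellFun_apply (n : ℕ) (a : T.Cell n) (f : X → 𝕜) (x : X) :
    cellFun n a f x = (if T.proj n x = a then (1 : 𝕜) else 0) * f x := rfl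

omit [IsUltrametricDist 𝕜] [CompleteSpace 𝕜] in
/-- `‖𝟙_a f‖ ≤ 1` when `‖f‖ ≤ 1`. [cite: MazurTateTeitelbaum1986Invent, §I.11] -/
theorem norm_cellFun_le (n : ℕ) (a : T.Cell n) {f : X → 𝕜} (hf1 : ∀ x, ‖f x‖ ≤ 1) (x : X) :
    ‖cellFun n a f x‖ ≤ 1 := by
  rw [cellFun_apply]
  split_ifs
  · rw [one_mul]; exact hf1 x
  · rw [zero_mul, norm_zero]; exact zero_le_one

omit [IsUltrametricDist 𝕜] [CompleteSpace 𝕜] in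
/-- `𝟙_a f` is uniformly continuous on a uniform tower (`f` uniformly continuous, `‖f‖ ≤ 1`).
[cite: MazurTateTeitelbaum1986Invent, §I.11] -/
theorem uniformContinuous_cellFun (hT : T.IsUniform) (n : ℕ) (a : T.Cell n) {f : X → 𝕜}
    (hf : UniformContinuous f) (hf1 : ∀ x, ‖f x‖ ≤ 1) : UniformContinuous (cellFun n a f) := by
  refine uniformContinuous_mul_of_norm_le (A := 1) (B := 1)
    (hT.uniformContinuous_of_proj_eq n (fun x y hxy ↦ by rw [hxy])) hf (fun x ↦ ?_) hf1
  split_ifs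
  · rw [norm_one]
  · rw [norm_zero]; exact zero_le_one

/-- **The distribution with density `f`**: `(f · D)(a) = ∫ 𝟙_a f dD` on every cell `a` (`T` uniform,
`f` uniformly continuous with `‖f‖ ≤ 1`, `𝕜` complete non-archimedean); additivity from the additivity
of the integral, bound `‖D‖`. [cite: deShalit1987, I.3.5 (11) (p. 18)]
[cite: MazurTateTeitelbaum1986Invent, §I.11] -/
def density (hT : T.IsUniform) (f : X → 𝕜) (hf : UniformContinuous f) (hf1 : ∀ x, ‖f x‖ ≤ 1) :
    BoundedDistribution T 𝕜 where
  μ n a := D.integral (cellFun n a f)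
  sum_fiber n a := by
    rw [← D.integral_finset_sum _ (fun b _ ↦ uniformContinuous_cellFun hT (n + 1) b hf hf1)]
    congr 1
    funext x
    simp only [cellFun_apply]
    rw [← Finset.sum_mul, Finset.sum_ite_eq]
    simp only [Finset.mem_filter, Finset.mem_univ, true_and, T.trans_proj]
  bound := D.bound
  bound_nonneg := D.bound_nonneg
  norm_le n a := by
    have h := D.norm_integral_le (uniformContinuous_cellFun hT n a hf hf1) zero_le_one
      (norm_cellFun_le n a hf1)
    rwa [mul_one] at h

/-- The level data of `f · D`. [cite: deShalit1987, I.3.5 (11) (p. 18)] -/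
@[simp] theorem density_μ (hT : T.IsUniform) (f : X → 𝕜) (hf : UniformContinuous f)
    (hf1 : ∀ x, ‖f x‖ ≤ 1) (n : ℕ) (a : T.Cell n) :
    (D.density hT f hf hf1).μ n a = D.integral (cellFun n a f) := rfl

/-- The bound of `f · D` is that of `D`. [cite: deShalit1987, I.3.5 (11) (p. 18)] -/
@[simp] theorem density_bound (hT : T.IsUniform) (f : X → 𝕜) (hf : UniformContinuous f)
    (hf1 : ∀ x, ‖f x‖ ≤ 1) : (D.density hT f hf hf1).bound = D.bound := rfl

/-- **The Riemann sums of `f · D`** are integrals against `D` of `f` times the level-`k` step function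
of the integrand: `RS_k(g; f·D) = ∫ g(x̃_k) f(x) dD(x)`, `x̃_k` the representative of the cell of `x`.
[cite: MazurTateTeitelbaum1986Invent, §I.11] -/
theorem riemannSum_density (hT : T.IsUniform) (f : X → 𝕜) (hf : UniformContinuous f)
    (hf1 : ∀ x, ‖f x‖ ≤ 1) (g : X → 𝕜) (k : ℕ) :
    (D.density hT f hf hf1).riemannSum g k = D.integral (fun x ↦ g (T.repr k (T.proj k x)) * f x) := by
  rw [riemannSum_def]
  have h1 : ∀ a : T.Cell k, (D.density hT f hf hf1).μ k a * g (T.repr k a) =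
      D.integral (fun x ↦ cellFun k a f x * g (T.repr k a)) := fun a ↦ by
    rw [density_μ, D.integral_mul_const _ (uniformContinuous_cellFun hT k a hf hf1)]
  simp_rw [h1]
  rw [← D.integral_finset_sum _ (fun a _ ↦ ?_)]
  · congr 1
    funext x
    simp only [cellFun_apply, ite_mul, one_mul, zero_mul]
    rw [Finset.sum_ite_eq]
    simp only [Finset.mem_univ, if_true, mul_comm (f x)]
  · have h := uniformContinuous_cellFun hT k a hf hf1
    exact uniformContinuous_mul_of_norm_le (A := 1) (B := ‖g (T.repr k a)‖) h uniformContinuous_const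
      (norm_cellFun_le k a hf1) (fun _ ↦ le_rfl)

/-- **`∫ g d(f·D) = ∫ g f dD`** for bounded uniformly continuous `g`: the Riemann sums of the left side
are `∫ g_k f dD` with `g_k → g` uniformly. [cite: deShalit1987, I.3.5 (11) (p. 18)]
[cite: MazurTateTeitelbaum1986Invent, §I.11] -/
theorem integral_density (hT : T.IsUniform) (f : X → 𝕜) (hf : UniformContinuous f)
    (hf1 : ∀ x, ‖f x‖ ≤ 1) {g : X → 𝕜} (hg : UniformContinuous g) {M : ℝ} (hM : ∀ x, ‖g x‖ ≤ M) :
    (D.density hT f hf hf1).integral g = D.integral (fun x ↦ g x * f x) := by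
  have hgk : ∀ k, UniformContinuous (fun x ↦ g (T.repr k (T.proj k x))) := fun k ↦
    hT.uniformContinuous_of_proj_eq k (fun x y hxy ↦ by rw [hxy])
  have hFk : ∀ k, UniformContinuous (fun x ↦ g (T.repr k (T.proj k x)) * f x) := fun k ↦
    uniformContinuous_mul_of_norm_le (hgk k) hf (fun x ↦ hM _) hf1
  have hF : UniformContinuous (fun x ↦ g x * f x) := uniformContinuous_mul_of_norm_le hg hf hM hf1
  -- `∫ g_k f dD → ∫ g f dD`
  have hlim : Tendsto (fun k ↦ D.integral (fun x ↦ g (T.repr k (T.proj k x)) * f x)) atTop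
      (𝓝 (D.integral (fun x ↦ g x * f x))) := by
    refine Metric.tendsto_atTop.mpr fun ε hε ↦ ?_
    have hb : 0 < D.bound + 1 := by linarith [D.bound_nonneg]
    obtain ⟨N, hN⟩ := T.exists_forall_norm_sub_le hg (div_pos hε hb)
    refine ⟨N, fun k hk ↦ ?_⟩
    rw [dist_eq_norm, ← D.integral_sub (hFk k) hF]
    have hpt : ∀ x, ‖g (T.repr k (T.proj k x)) * f x - g x * f x‖ ≤ ε / (D.bound + 1) := fun x ↦ by
      rw [← sub_mul, norm_mul]
      calc ‖g (T.repr k (T.proj k x)) - g x‖ * ‖f x‖ ≤ ε / (D.bound + 1) * 1 := by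
            refine mul_le_mul (hN k hk _ _ (T.proj_repr k _)) (hf1 x) (norm_nonneg _) (div_pos hε hb).le
        _ = ε / (D.bound + 1) := mul_one _
    calc ‖D.integral (fun x ↦ g (T.repr k (T.proj k x)) * f x - g x * f x)‖
        ≤ D.bound * (ε / (D.bound + 1)) := D.norm_integral_le ((hFk k).sub hF) (div_pos hε hb).le hpt
      _ < ε := by rw [mul_div_assoc', div_lt_iff₀ hb]; nlinarith [D.bound_nonneg]
  have hRS : Tendsto ((D.density hT f hf hf1).riemannSum g) atTop (𝓝 (D.integral (fun x ↦ g x * f x))) := by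
    have heq : (D.density hT f hf hf1).riemannSum g =
        fun k ↦ D.integral (fun x ↦ g (T.repr k (T.proj k x)) * f x) :=
      funext fun k ↦ D.riemannSum_density hT f hf hf1 g k
    rw [heq]; exact hlim
  exact tendsto_nhds_unique ((D.density hT f hf hf1).tendsto_riemannSum_integral hg) hRS

end BoundedDistribution

/-! ### §3. `ℤ_p`: the density `x⁻¹` on the units, and the moment shift -/

section PadicUnits

variable {p : ℕ} [Fact p.Prime]
variable {𝕜 : Type*} [NormedField 𝕜] [NormedAlgebra ℚ_[p] 𝕜]

variable (𝕜) in
/-- **`x ↦ x⁻¹` on `ℤ_p^×`, `0` on `pℤ_p`**, read in `𝕜` — the density turning `κμ_β` into `μ_β` on the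
units. [cite: deShalit1987, I.3.5 (11) (p. 18)] -/
def unitInv (x : ℤ_[p]) : 𝕜 := if h : IsUnit x then padicIntCast 𝕜 ((h.unit⁻¹ : ℤ_[p]ˣ) : ℤ_[p]) else 0

/-- `unitInv` on a unit. [cite: deShalit1987, I.3.5 (11) (p. 18)] -/
theorem unitInv_of_isUnit {x : ℤ_[p]} (h : IsUnit x) :
    unitInv 𝕜 x = padicIntCast 𝕜 ((h.unit⁻¹ : ℤ_[p]ˣ) : ℤ_[p]) := by
  rw [unitInv, dif_pos h]

/-- `unitInv` off the units. [cite: deShalit1987, I.3.5 (11) (p. 18)] -/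
theorem unitInv_of_not_isUnit {x : ℤ_[p]} (h : ¬ IsUnit x) : unitInv 𝕜 x = 0 := by
  rw [unitInv, dif_neg h]

/-- `‖unitInv x‖ ≤ 1`. [cite: deShalit1987, I.3.5 (11) (p. 18)] -/
theorem norm_unitInv_le (x : ℤ_[p]) : ‖unitInv 𝕜 x‖ ≤ 1 := by
  by_cases h : IsUnit x
  · rw [unitInv_of_isUnit h, norm_padicIntCast]; exact PadicInt.norm_le_one _
  · rw [unitInv_of_not_isUnit h, norm_zero]; exact zero_le_one

/-- `x · x⁻¹ = 1` on the units: `unitInv x · x^{k+1} = x^k` there. [cite: deShalit1987, I.3.5 (11) (p. 18)] -/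
theorem unitInv_mul_padicIntCast_pow_succ {x : ℤ_[p]} (h : IsUnit x) (k : ℕ) :
    unitInv 𝕜 x * padicIntCast 𝕜 (x ^ (k + 1)) = padicIntCast 𝕜 (x ^ k) := by
  rw [unitInv_of_isUnit h, ← map_mul, pow_succ', ← mul_assoc, Units.inv_mul_of_eq h.unit_spec, one_mul]

/-- Two `p`-adic integers at distance `< 1` are units together (`ℤ_p^×` is open and closed).
[cite: deShalit1987, I.3.3 (7′) (p. 17–18)] -/
theorem isUnit_iff_of_norm_sub_lt_one {x y : ℤ_[p]} (hxy : ‖x - y‖ < 1) : IsUnit x ↔ IsUnit y := by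
  have key : ∀ {a b : ℤ_[p]}, ‖a - b‖ < 1 → ‖a‖ = 1 → ‖b‖ = 1 := fun {a b} hab ha ↦ by
    refine le_antisymm (PadicInt.norm_le_one b) (not_lt.mp fun hb ↦ ?_)
    have h : ‖a‖ ≤ max ‖a - b‖ ‖b‖ := by
      have h' := PadicInt.nonarchimedean (a - b) b
      rwa [sub_add_cancel] at h'
    rw [ha] at h
    exact absurd h (not_le.mpr (max_lt hab hb))
  rw [PadicInt.isUnit_iff, PadicInt.isUnit_iff]
  exact ⟨key hxy, key (by rwa [norm_sub_rev])⟩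

/-- **`unitInv` is uniformly continuous** (an isometry on `ℤ_p^×`, which is open and closed).
[cite: deShalit1987, I.3.5 (11) (p. 18)] -/
theorem uniformContinuous_unitInv : UniformContinuous (unitInv (p := p) 𝕜) := by
  refine Metric.uniformContinuous_iff.mpr fun ε hε ↦ ⟨min ε 1, lt_min hε one_pos, fun {x y} hxy ↦ ?_⟩
  rw [dist_eq_norm] at hxy ⊢
  have h1 : ‖x - y‖ < 1 := lt_of_lt_of_le hxy (min_le_right _ _)
  have hε' : ‖x - y‖ < ε := lt_of_lt_of_le hxy (min_le_left _ _)
  by_cases hx : IsUnit x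
  · have hy : IsUnit y := (isUnit_iff_of_norm_sub_lt_one h1).mp hx
    have key : ((hx.unit⁻¹ : ℤ_[p]ˣ) : ℤ_[p]) - ((hy.unit⁻¹ : ℤ_[p]ˣ) : ℤ_[p]) =
        (hx.unit⁻¹ : ℤ_[p]ˣ) * ((hy.unit : ℤ_[p]) - hx.unit) * (hy.unit⁻¹ : ℤ_[p]ˣ) := by
      rw [mul_sub, sub_mul, Units.mul_inv_cancel_right, Units.inv_mul, one_mul]
    rw [unitInv_of_isUnit hx, unitInv_of_isUnit hy, ← map_sub, norm_padicIntCast, key, norm_mul,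
      norm_mul, PadicInt.isUnit_iff.mp (Units.isUnit _), PadicInt.isUnit_iff.mp (Units.isUnit _), one_mul,
      mul_one, IsUnit.unit_spec, IsUnit.unit_spec, norm_sub_rev]
    exact hε'
  · have hy : ¬ IsUnit y := fun hy ↦ hx ((isUnit_iff_of_norm_sub_lt_one h1).mpr hy)
    rw [unitInv_of_not_isUnit hx, unitInv_of_not_isUnit hy, sub_zero, norm_zero]
    exact hε

/-- "`x mod p` is a unit" iff `x ∈ ℤ_p^×` (the indicator used by `restrictUnits`).
[cite: deShalit1987, I.3.3 (7′) (p. 17–18)] -/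
theorem isUnit_toZModPow_one_iff (x : ℤ_[p]) : IsUnit (PadicInt.toZModPow 1 x) ↔ IsUnit x := by
  have hp : p.Prime := Fact.out
  -- `x ≡ v mod p`, `v` the canonical representative
  have hdvd : (p : ℤ_[p]) ∣ x - ((PadicInt.toZModPow 1 x).val : ℤ_[p]) := by
    have hker : x - ((PadicInt.toZModPow 1 x).val : ℤ_[p]) ∈
        RingHom.ker (PadicInt.toZModPow 1 : ℤ_[p] →+* ZMod (p ^ 1)) := by
      haveI : NeZero (p ^ 1) := ⟨pow_ne_zero _ hp.ne_zero⟩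
      rw [RingHom.mem_ker, map_sub, map_natCast, ZMod.natCast_zmod_val, sub_self]
    rw [PadicInt.ker_toZModPow, Ideal.mem_span_singleton, pow_one] at hker
    exact hker
  have h1 : IsUnit x ↔ ¬ (p : ℤ_[p]) ∣ x := by
    rw [PadicInt.isUnit_iff, ← PadicInt.norm_lt_one_iff_dvd, not_lt]
    exact ⟨fun h ↦ h.ge, fun h ↦ le_antisymm (PadicInt.norm_le_one x) h⟩
  have h2 : (p : ℤ_[p]) ∣ x ↔ (p : ℤ_[p]) ∣ ((PadicInt.toZModPow 1 x).val : ℤ_[p]) := by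
    constructor
    · intro h
      have h' := dvd_sub h hdvd
      rwa [sub_sub_cancel] at h'
    · intro h
      have h' := dvd_add hdvd h
      rwa [sub_add_cancel] at h'
  have h3 : (p : ℤ_[p]) ∣ ((PadicInt.toZModPow 1 x).val : ℤ_[p]) ↔ p ∣ (PadicInt.toZModPow 1 x).val := by
    rw [← PadicInt.norm_lt_one_iff_dvd]
    have h' := PadicInt.norm_int_lt_one_iff_dvd (p := p) ((PadicInt.toZModPow 1 x).val : ℤ)
    rw [Int.cast_natCast, Int.natCast_dvd_natCast] at h'
    exact h'
  rw [ZMod_isUnit_iff_not_dvd_val one_pos, h1, h2, h3]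

variable [IsUltrametricDist 𝕜] [CompleteSpace 𝕜]

omit [IsUltrametricDist 𝕜] [CompleteSpace 𝕜] in
/-- `x ↦ x^k` (read in `𝕜`) is uniformly continuous on `ℤ_p` (the moment integrands of (11)).
[cite: deShalit1987, I.3.5 (11) (p. 18)] -/
theorem uniformContinuous_padicIntCast_pow (k : ℕ) :
    UniformContinuous (fun x : ℤ_[p] ↦ padicIntCast 𝕜 (x ^ k)) :=
  CompactSpace.uniformContinuous_of_continuous
    ((continuous_padicIntCast (𝕜 := 𝕜)).comp (continuous_pow k))

/-- **The moment shift `∫_{ℤ_p^×} x^{k+1} d(x⁻¹·ν) = ∫_{ℤ_p^×} x^k dν`** (de Shalit's (11) read through the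
density: with `ν` the measure of `h_β = D log̃ g_β`, i.e. `ν = κμ_β`, the left side is the `(k+1)`-st
moment of `μ_β` on the units and the right side is `[S^0] D^k h_β = D^{k+1} log̃ g_β (0)`). The left
integral is against `restrictUnits (x⁻¹ · ν)` on the shifted tower, the right one against `ν` with the
unit indicator, as in `integral_restrictUnits`. [cite: deShalit1987, I.3.5 (11) (p. 18), II.4.7 (15)–(17) (p. 60)] -/
theorem integral_restrictUnits_density_unitInv_pow_succ
    (ν : BoundedDistribution (ProfiniteTower.padicInt p) 𝕜) (k : ℕ) :
    (restrictUnits (ν.density (ProfiniteTower.padicInt_isUniform p) (unitInv 𝕜)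
        uniformContinuous_unitInv norm_unitInv_le)).integral (fun x ↦ padicIntCast 𝕜 (x ^ (k + 1))) =
      ν.integral (fun x ↦ (if IsUnit (PadicInt.toZModPow 1 x) then (1 : 𝕜) else 0) *
        padicIntCast 𝕜 (x ^ k)) := by
  have hind : UniformContinuous
      (fun x : ℤ_[p] ↦ (if IsUnit (PadicInt.toZModPow 1 x) then (1 : 𝕜) else 0)) :=
    (ProfiniteTower.padicInt_isUniform p).uniformContinuous_of_proj_eq 1 (fun x y hxy ↦ by
      simp only [ProfiniteTower.padicInt_proj] at hxy; rw [hxy])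
  have hind1 : ∀ x : ℤ_[p], ‖(if IsUnit (PadicInt.toZModPow 1 x) then (1 : 𝕜) else 0)‖ ≤ 1 :=
    fun x ↦ by
      split_ifs
      · rw [norm_one]
      · rw [norm_zero]; exact zero_le_one
  have hpow1 : ∀ (j : ℕ) (x : ℤ_[p]), ‖padicIntCast 𝕜 (x ^ j)‖ ≤ 1 := fun j x ↦ by
    rw [norm_padicIntCast]; exact PadicInt.norm_le_one _
  have hF : UniformContinuous (fun x : ℤ_[p] ↦
      (if IsUnit (PadicInt.toZModPow 1 x) then (1 : 𝕜) else 0) * padicIntCast 𝕜 (x ^ (k + 1))) :=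
    uniformContinuous_mul_of_norm_le hind (uniformContinuous_padicIntCast_pow (k + 1)) hind1
      (hpow1 (k + 1))
  rw [integral_restrictUnits _ hF, ν.integral_density _ _ _ _ hF (M := 1) (fun x ↦ ?_)]
  · congr 1
    funext x
    by_cases hx : IsUnit x
    · rw [mul_assoc, mul_comm (padicIntCast 𝕜 _), unitInv_mul_padicIntCast_pow_succ hx]
    · have hx' : ¬ IsUnit (PadicInt.toZModPow 1 x) := fun h ↦ hx ((isUnit_toZModPow_one_iff x).mp h)
      rw [if_neg hx', zero_mul, zero_mul, zero_mul]
  · rw [norm_mul]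
    exact mul_le_one₀ (hind1 x) (norm_nonneg _) (hpow1 _ x)

end PadicUnits

end Literature.NumberTheory.EllipticCurves

end
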